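import Literature.MathematicalPhysics.QuantumLattice.HubbardGridFieldSubstitution
import Literature.MathematicalPhysics.QuantumLattice.GrassmannKernelsPresented
import Literature.MathematicalPhysics.QuantumLattice.GrassmannMonomialDeletion
import HarnessLib

/-!
# The kernels of the grid-local quartic Hubbard vertex: presentation, pinned `ℓ¹` norm `≤ |U|·ε_N`, parity

Topic `MathematicalPhysics/QuantumLattice`; companion of `HubbardGridFieldSubstitution` (the grid-LOCAL quartic
`hubbardGridInteraction L N β U = U ε_N Σ_{(j,x⃗)} ψ⁺↑ψ⁻↑ψ⁺↓ψ⁻↓((j,x⃗))`, `ε_N = β/N`, whose image under the grid substitution is the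
strictly-conserving `hubbardInteraction` for `4M ≤ N + 1`).  For the determinant-bounded single-scale step
`GrassmannEffectiveActionBoundDB.sum_norm_kernel_effAction_le_of_gramBounded` run on the grid algebra one needs, degree by degree, the
PINNED `ℓ¹` sums `Σ_{X : X p = w} ‖kernel V m X‖` of the initial interaction (its hypothesis `hN`).  Here:

* `gridWordLegs p` (the four legs of the grid word at `p`, in the word's order), `gridWord_eq_genProd`;
* `gridInteractionCoeff` and **`hubbardGridInteraction_eq_presented`** — `V_N = presented φ` with `φ(X) = Σ_p [X = legs(p)]·Uε_N`
  (Salmhofer's presentation (4.95) of a local quartic);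
* `sum_norm_gridInteractionCoeff_le` — every pinned sum of `φ` is `≤ |U||β|/N` (a leg `w` belongs to exactly one grid word);
* **`sum_norm_kernel_hubbardGridInteraction_le`**: `Σ_{X : X p = w} ‖kernel V_N 4 X‖ ≤ |U|·|β|/N` for every slot `p` and leg `w`, EVERY `L, N`
  (no volume or frequency-count factor — the ultralocality that the strictly-conserving momentum-space vertex lacks on the `2M` grid,
  `SectorisedKernelNorm` T1), via `kernelNorm_kernel_presented_le` (the antisymmetrisation costs nothing);
* `kernel_hubbardGridInteraction_of_ne` (degrees `≠ 4` vanish) and `hubbardGridInteraction_mem_evenPart`.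

Everything is proved; the two definitions are bookkeeping (the leg enumeration and the presentation coefficient); no named facts.

## Sources

M. Salmhofer, *Renormalization* (1999), §4.2.4 (4.58) (time-lattice action), §4.3 (4.95) (coefficient functions) [`Salmhofer1999`];
G. Benfatto, A. Giuliani, V. Mastropietro, Ann. Henri Poincaré 7 (2006) 809–898, §2.1 (2.6a) [`BenfattoGiulianiMastropietro2006`].
-/

noncomputable section

namespace Literature.MathematicalPhysics.QuantumLattice

open GrassmannAlgebra Finset Literature.Probability.LatticeModels

section GridInteractionKernels

variable (L N : ℕ) [NeZero L]

/-- The four legs `((p,↑),+), ((p,↑),−), ((p,↓),+), ((p,↓),−)` of the grid word at `p`, in the word's order.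
[cite: Salmhofer1999, §4.2.4 (4.58)] -/
def gridWordLegs (p : GridPoint L N) : Fin 4 → GridLeg (GridPoint L N) :=
  ![(((p, 0), 0) : GridLeg (GridPoint L N)), ((p, 0), 1), ((p, 1), 0), ((p, 1), 1)]

/-- **The presentation coefficient of the grid vertex**: `φ(X) = Σ_p [X = legs(p)] · U ε_N` (at most one `p` contributes).
[cite: Salmhofer1999, §4.3 (4.95)] -/
def gridInteractionCoeff (β U : ℝ) (X : Fin 4 → GridLeg (GridPoint L N)) : ℂ :=
  ∑ p : GridPoint L N, if X = gridWordLegs L N p then ((U * (β / N) : ℝ) : ℂ) else 0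

variable {L N}

omit [NeZero L] in
/-- Every leg of the word at `p` sits at the point `p`. [cite: Salmhofer1999, §4.2.4 (4.58)] -/
theorem gridWordLegs_point (p : GridPoint L N) (q : Fin 4) : (gridWordLegs L N p q).1.1 = p := by
  fin_cases q <;> rfl

omit [NeZero L] in
/-- The grid word is the monomial of its leg string: `gridWord p = genProd (gridWordLegs p)`. [cite: Salmhofer1999, §4.2.4 (4.58)] -/
theorem gridWord_eq_genProd (p : GridPoint L N) : gridWord L N p = genProd ℂ (gridWordLegs L N p) := by
  rw [gridWord, gridWordLegs, genProd_succ, genProd_succ, genProd_succ, genProd_succ, genProd_zero, mul_one]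
  simp only [mul_assoc]
  rfl

/-- **The grid vertex is the presented polynomial of `gridInteractionCoeff`**: `V_N = Σ_X φ(X) ψ(X₀)ψ(X₁)ψ(X₂)ψ(X₃)`.
[cite: Salmhofer1999, §4.3 (4.95)] -/
theorem hubbardGridInteraction_eq_presented (β U : ℝ) :
    hubbardGridInteraction L N β U = presented ℂ (gridInteractionCoeff L N β U) := by
  rw [presented, hubbardGridInteraction, smul_sum]
  simp_rw [gridInteractionCoeff, sum_smul, ite_smul, zero_smul]
  rw [sum_comm]
  exact sum_congr rfl fun p _ => by rw [sum_ite_eq' univ (gridWordLegs L N p), if_pos (mem_univ _), gridWord_eq_genProd]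

/-- **Pinned sums of the presentation coefficient**: for every slot `q` and leg `w`, `Σ_{X : X q = w} ‖φ(X)‖ ≤ |U|·|β|/N`
(the leg `w` lies in the word of the single point `w.1.1`). [cite: Salmhofer1999, §4.3 (4.95)] -/
theorem sum_norm_gridInteractionCoeff_le (β U : ℝ) (q : Fin 4) (w : GridLeg (GridPoint L N)) :
    ∑ X ∈ univ.filter (fun X : Fin 4 → GridLeg (GridPoint L N) => X q = w), ‖gridInteractionCoeff L N β U X‖ ≤ |U| * |β| / N := by
  have hc : ‖(((U * (β / N) : ℝ)) : ℂ)‖ = |U| * |β| / N := by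
    rw [Complex.norm_real, Real.norm_eq_abs, abs_mul, abs_div, Nat.abs_cast, mul_div_assoc]
  have hcn : 0 ≤ |U| * |β| / N := by positivity
  calc ∑ X ∈ univ.filter (fun X : Fin 4 → GridLeg (GridPoint L N) => X q = w), ‖gridInteractionCoeff L N β U X‖
      ≤ ∑ X ∈ univ.filter (fun X : Fin 4 → GridLeg (GridPoint L N) => X q = w),
          ∑ p : GridPoint L N, (if X = gridWordLegs L N p then |U| * |β| / N else 0) := by
        refine sum_le_sum fun X _ => (norm_sum_le _ _).trans (sum_le_sum fun p _ => ?_)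
        split_ifs
        · exact hc.le
        · simp
    _ = ∑ p : GridPoint L N, ∑ X ∈ univ.filter (fun X : Fin 4 → GridLeg (GridPoint L N) => X q = w),
          (if X = gridWordLegs L N p then |U| * |β| / N else 0) := sum_comm
    _ = ∑ p : GridPoint L N, (if gridWordLegs L N p q = w then |U| * |β| / N else 0) := by
        refine sum_congr rfl fun p _ => ?_
        rw [sum_ite_eq' (univ.filter fun X : Fin 4 → GridLeg (GridPoint L N) => X q = w) (gridWordLegs L N p)
          (fun _ => |U| * |β| / N)]
        simp only [mem_filter, mem_univ, true_and]
    _ ≤ ∑ p : GridPoint L N, (if p = w.1.1 then |U| * |β| / N else 0) := by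
        refine sum_le_sum fun p _ => ?_
        by_cases h : gridWordLegs L N p q = w
        · rw [if_pos h, if_pos (by rw [← h, gridWordLegs_point])]
        · rw [if_neg h]
          split_ifs
          · exact hcn
          · exact le_rfl
    _ = |U| * |β| / N := by
        rw [sum_ite_eq' univ w.1.1 (fun _ => |U| * |β| / N), if_pos (mem_univ _)]

/-- **The pinned `ℓ¹` norm of the grid vertex's `4`-point kernel**: for every slot `p` and leg `w`,
`Σ_{X : X p = w} ‖kernel V_N 4 X‖ ≤ |U|·|β|/N` — every `L, N`; the `N(2)` input of the determinant-bounded single-scale step run on the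
grid algebra (the antisymmetrisation's `(4!)⁻¹` pays for the orderings, `kernelNorm_kernel_presented_le`).
[cite: Salmhofer1999, §4.3 (4.95)] -/
theorem sum_norm_kernel_hubbardGridInteraction_le (β U : ℝ) (p : Fin 4) (w : GridLeg (GridPoint L N)) :
    ∑ X ∈ univ.filter (fun X : Fin 4 → GridLeg (GridPoint L N) => X p = w),
      ‖kernel ℂ (hubbardGridInteraction L N β U) 4 X‖ ≤ |U| * |β| / N := by
  have hB : 0 ≤ |U| * |β| / N := by positivity
  have h1 : kernelNorm 1 4 (kernel ℂ (hubbardGridInteraction L N β U) 4) ≤ |U| * |β| / N := by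
    rw [hubbardGridInteraction_eq_presented]
    refine (kernelNorm_kernel_presented_le zero_le_one 4 _).trans ?_
    exact kernelNorm_succ_le_of_forall 1 3 _ hB fun q x => by
      rw [one_pow, one_mul]; exact sum_norm_gridInteractionCoeff_le β U q x
  have h2 := pinnedSum_le_kernelNorm (𝕜 := ℂ) 1 3 (kernel ℂ (hubbardGridInteraction L N β U) 4) p w
  rw [one_pow, one_mul] at h2
  exact h2.trans h1

/-- The grid vertex has kernels only in degree `4`. [cite: Salmhofer1999, §4.3 (4.95)] -/
theorem kernel_hubbardGridInteraction_of_ne (β U : ℝ) {m : ℕ} (hm : m ≠ 4) (X : Fin m → GridLeg (GridPoint L N)) :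
    kernel ℂ (hubbardGridInteraction L N β U) m X = 0 := by
  rw [hubbardGridInteraction_eq_presented]
  exact kernel_presented_of_ne ℂ _ X hm

/-- The grid vertex is even (a combination of degree-`4` monomials). [cite: Salmhofer1999, §4.2.4 (4.58)] -/
theorem hubbardGridInteraction_mem_evenPart (β U : ℝ) :
    hubbardGridInteraction L N β U ∈ evenPart ℂ (GridLeg (GridPoint L N)) := by
  rw [hubbardGridInteraction_eq_presented, presented, mem_evenPart_iff]
  refine Submodule.sum_mem _ fun X _ => Submodule.smul_mem _ _ ?_
  have h := genProd_mem_evenOdd ℂ X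
  have h4 : ((4 : ℕ) : ZMod 2) = 0 := by decide
  rwa [h4] at h

/-- The grid quadratic term (density) is even. [cite: Salmhofer1999, §4.2.4 (4.58)] -/
theorem hubbardGridQuadratic_mem_evenPart (β : ℝ) :
    hubbardGridQuadratic L N β ∈ evenPart ℂ (GridLeg (GridPoint L N)) := by
  rw [hubbardGridQuadratic, mem_evenPart_iff]
  refine Submodule.smul_mem _ _ (Submodule.sum_mem _ fun p _ => Submodule.sum_mem _ fun σ _ => ?_)
  exact CliffordAlgebra.ι_mul_ι_mem_evenOdd_zero _ _ _

end GridInteractionKernels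

end Literature.MathematicalPhysics.QuantumLattice

end
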